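import Summits.CriticalPhenomena.SAWScalingLimit.Theses.SAWRenewalTightness

/-!
# `IsProbabilityMeasure μ` is not load-bearing in crux `SubseqIdentification` (stmt-CriticalPhenomena-0783)

Refuter (cdisprove cycle 1), load-bearing analysis continued: the hypothesis `IsProbabilityMeasure μ`
of the shared crux `Summit.CriticalPhenomena.SAWScalingLimit.Theses.SAWRenewalTightness.SubseqIdentification`
is DERIVABLE from the others — under an endpoint approximation the critical SAW laws are eventually
probability measures (`eventually_isProbabilityMeasure_law`, re-hosting the finiteness argument of the
route's deciding theorem `closes`), so the test integral of `f ≡ 1` pins `μ univ = 1`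
(`isProbabilityMeasure_of_hyps`); hence the crux is equivalent to its version without that hypothesis
(`subseqIdentification_iff_withoutProb`).
-/

noncomputable section

open Literature.Probability.RandomPlanarGeometry Literature.Probability.RandomPlanarGeometry.SAW
  Literature.Probability.LatticeModels Literature.Probability.Percolation MeasureTheory Filter
  Topology Set
open scoped NNReal ENNReal BoundedContinuousFunction

namespace Summit.CriticalPhenomena.SAWScalingLimit.Theorems.SubseqIdentification.Negative

/-- Under an endpoint approximation the critical SAW laws are eventually probability measures
(re-hosted from the route's deciding theorem `closes`: `a δ, b δ` joined ⇒ a SAW exists, positive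
weight; `Ω_δ` finite ⇒ finitely many SAWs, finite total weight). [folklore] -/
theorem eventually_isProbabilityMeasure_law {D : DobrushinDomain} {a b : ℝ → Site 2}
    (hab : IsEndpointApprox D a b) :
    ∀ᶠ δ in 𝓝[>] (0 : ℝ), IsProbabilityMeasure (law D.carrier δ (a δ) (b δ)) := by
  classical
  have hxc : 0 < Literature.Probability.RandomPlanarGeometry.SAW.criticalFugacity := by
    have h := Literature.Probability.RandomPlanarGeometry.SAW.Zd.connectiveConstant_pos 2
    rw [Literature.Probability.RandomPlanarGeometry.SAW.Zd.connectiveConstant_two] at h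
    unfold Literature.Probability.RandomPlanarGeometry.SAW.criticalFugacity
    exact inv_pos.2 h
  -- (1) for all small `δ > 0` the critical SAW law of `Ω_δ` from `a_δ` to `b_δ` is a probability
  -- measure: `a_δ, b_δ` are joined (a SAW exists, positive weight) and `Ω_δ` is finite (finitely
  -- many SAWs, finite total weight)
  have hprob : ∀ᶠ δ in 𝓝[>] (0 : ℝ), IsProbabilityMeasure
      (Literature.Probability.RandomPlanarGeometry.SAW.law D.carrier δ (a δ) (b δ)) := by
    filter_upwards [hab.reachable, self_mem_nhdsWithin] with δ hreach hδpos
    have hδ : (0 : ℝ) < δ := hδpos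
    have hfin : (Literature.Probability.LatticeModels.meshDomain D.carrier δ).Finite :=
      Literature.Probability.LatticeModels.meshDomain_finite D.isBounded hδ
    haveI hLF : (Literature.Probability.LatticeModels.discreteDomainGraph D.carrier δ).LocallyFinite :=
      fun v => (hfin.subset fun w hw =>
        (Literature.Probability.LatticeModels.discreteDomainGraph_adj_iff.1
          ((SimpleGraph.mem_neighborSet _ _ _).1 hw)).2.2).fintype
    -- every vertex of a walk of `Ω_δ` after the first lies in `Ω_δ`
    have hsupp : ∀ {u v : Literature.Probability.LatticeModels.Site 2}
        (p : (Literature.Probability.LatticeModels.discreteDomainGraph D.carrier δ).Walk u v),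
        ∀ w ∈ p.support.tail, w ∈ Literature.Probability.LatticeModels.meshDomain D.carrier δ := by
      intro u v p
      induction p with
      | nil => intro w hw; simp at hw
      | cons h q ih =>
        intro w hw
        rw [SimpleGraph.Walk.support_cons, List.tail_cons, SimpleGraph.Walk.mem_support_iff] at hw
        rcases hw with rfl | hw
        · exact (Literature.Probability.LatticeModels.discreteDomainGraph_adj_iff.1 h).2.2
        · exact ih w hw
    -- hence a self-avoiding walk of `Ω_δ` has at most `|Ω_δ|` steps
    have hlen : ∀ {u v : Literature.Probability.LatticeModels.Site 2}
        (p : (Literature.Probability.LatticeModels.discreteDomainGraph D.carrier δ).Walk u v),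
        p.IsPath → p.length < hfin.toFinset.card + 1 := by
      intro u v p hp
      have hnd : p.support.tail.Nodup := List.Nodup.sublist (List.tail_sublist _) hp.support_nodup
      have h1 : p.support.tail.length = p.length := by
        rw [List.length_tail, SimpleGraph.Walk.length_support]
        rfl
      have h2 : p.support.tail.toFinset ⊆ hfin.toFinset := by
        intro w hw
        rw [Set.Finite.mem_toFinset]
        exact hsupp p w (List.mem_toFinset.1 hw)
      have h3 := Finset.card_le_card h2
      rw [List.toFinset_card_of_nodup hnd, h1] at h3
      omega
    haveI hfinite : Finite
        (Literature.Probability.RandomPlanarGeometry.SAW.DomainSAW D.carrier δ (a δ) (b δ)) := by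
      refine Finite.of_injective
        (β := {p : (Literature.Probability.LatticeModels.discreteDomainGraph D.carrier δ).Walk
          (a δ) (b δ) // p.IsPath ∧ p.length < hfin.toFinset.card + 1})
        (fun γ => ⟨γ.walk, γ.isPath, hlen γ.walk γ.isPath⟩) ?_
      rintro ⟨p, hp⟩ ⟨q, hq⟩ h
      have hpq : p = q := congrArg Subtype.val h
      cases hpq
      rfl
    haveI := Fintype.ofFinite
      (Literature.Probability.RandomPlanarGeometry.SAW.DomainSAW D.carrier δ (a δ) (b δ))
    -- total weight: finite …
    have huniv : Literature.Probability.RandomPlanarGeometry.SAW.weight D.carrier δ (a δ) (b δ)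
        Set.univ = ∑' γ : Literature.Probability.RandomPlanarGeometry.SAW.DomainSAW D.carrier δ
          (a δ) (b δ), ENNReal.ofReal
            (Literature.Probability.RandomPlanarGeometry.SAW.criticalFugacity ^ γ.length) := by
      rw [Literature.Probability.RandomPlanarGeometry.SAW.weight,
        MeasureTheory.Measure.sum_apply _ MeasurableSet.univ]
      simp
    have htop : Literature.Probability.RandomPlanarGeometry.SAW.weight D.carrier δ (a δ) (b δ)
        Set.univ ≠ ⊤ := by
      rw [huniv, tsum_fintype]
      exact ENNReal.sum_ne_top.2 fun _ _ => ENNReal.ofReal_ne_top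
    -- … and positive
    have h0 : Literature.Probability.RandomPlanarGeometry.SAW.weight D.carrier δ (a δ) (b δ)
        Set.univ ≠ 0 := by
      obtain ⟨p⟩ := hreach
      let γ₀ : Literature.Probability.RandomPlanarGeometry.SAW.DomainSAW D.carrier δ (a δ) (b δ) :=
        ⟨p.bypass, p.bypass_isPath⟩
      have h1 : Literature.Probability.RandomPlanarGeometry.SAW.weight D.carrier δ (a δ) (b δ) {γ₀}
          ≤ Literature.Probability.RandomPlanarGeometry.SAW.weight D.carrier δ (a δ) (b δ)
            Set.univ := measure_mono (Set.subset_univ _)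
      rw [Literature.Probability.RandomPlanarGeometry.SAW.weight_singleton] at h1
      have h2 : 0 < ENNReal.ofReal
          (Literature.Probability.RandomPlanarGeometry.SAW.criticalFugacity ^ γ₀.length) :=
        ENNReal.ofReal_pos.2 (pow_pos hxc _)
      exact (h2.trans_le h1).ne'
    constructor
    rw [Literature.Probability.RandomPlanarGeometry.SAW.law, Measure.smul_apply, smul_eq_mul,
      ENNReal.inv_mul_cancel h0 htop]
  exact hprob

/-- **`IsProbabilityMeasure μ` follows from the other hypotheses**: the laws are eventually
probability measures along `s n → 0⁺`, so the test integral of `f ≡ 1` tends to `1 = μ.real univ`,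
whence `μ univ = 1` (`toReal = 1` excludes both `0` and `∞`). [folklore] -/
theorem isProbabilityMeasure_of_hyps {D : DobrushinDomain} {a b : ℝ → Site 2}
    (hab : IsEndpointApprox D a b) {s : ℕ → ℝ} (hs : Tendsto s atTop (𝓝[>] (0 : ℝ)))
    {μ : Measure (CurveClass ℂ)}
    (hlim : ∀ f : CurveClass ℂ →ᵇ ℝ, Tendsto (fun n => ∫ γ, f γ.curve
      ∂(law D.carrier (s n) (a (s n)) (b (s n)))) atTop (𝓝 (∫ x, f x ∂μ))) :
    IsProbabilityMeasure μ := by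
  have hev : ∀ᶠ n in atTop, IsProbabilityMeasure (law D.carrier (s n) (a (s n)) (b (s n))) :=
    hs.eventually (eventually_isProbabilityMeasure_law hab)
  have h1 := hlim 1
  simp only [BoundedContinuousFunction.coe_one, Pi.one_apply, integral_const, smul_eq_mul,
    mul_one] at h1
  have h2 : Tendsto (fun n => (law D.carrier (s n) (a (s n)) (b (s n))).real univ) atTop (𝓝 1) :=
    tendsto_const_nhds.congr' (hev.mono fun n hn => by
      haveI := hn
      exact probReal_univ.symm)
  have h3 : μ.real univ = 1 := tendsto_nhds_unique h1 h2
  rw [measureReal_def, ENNReal.toReal_eq_one_iff] at h3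
  exact ⟨h3⟩

open Summit.CriticalPhenomena.SAWScalingLimit.Theses.SAWRenewalTightness in
/-- **The hypothesis `IsProbabilityMeasure μ` is NOT load-bearing**: the crux is EQUIVALENT to its
version without it. (Information for provers: nothing is gained or lost by it.) [folklore] -/
theorem subseqIdentification_iff_withoutProb :
    SubseqIdentification ↔
      ∀ (D : DobrushinDomain) (a b : ℝ → Site 2), IsEndpointApprox D a b →
        ∀ (s : ℕ → ℝ) (μ : Measure (CurveClass ℂ)), Tendsto s atTop (𝓝[>] (0 : ℝ)) →
        (∀ f : CurveClass ℂ →ᵇ ℝ, Tendsto (fun n => ∫ γ, f γ.curve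
          ∂(law D.carrier (s n) (a (s n)) (b (s n)))) atTop (𝓝 (∫ x, f x ∂μ))) →
        IsSLELaw ((8 : ℝ≥0) / 3) D μ := by
  constructor
  · intro h D a b hab s μ hs hlim
    exact h D a b hab s μ hs (isProbabilityMeasure_of_hyps hab hs hlim) hlim
  · intro h D a b hab s μ hs _ hlim
    exact h D a b hab s μ hs hlim

end Summit.CriticalPhenomena.SAWScalingLimit.Theorems.SubseqIdentification.Negative
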